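import Literature.Computability.Cryptography.LWEGuessTestLayout
import Literature.Computability.Cryptography.LWECandidateSelectClose
import Literature.Computability.Complexity.CodeFPListKit
import HarnessLib

/-!
# The selection among candidate distinguishers as a typed polynomial-time program on the measurement bits

Topic `Computability/Cryptography` (LWE), grouping namespace `BLPRS2013.KProg`; program-level companion of `LWECandidateSelect.lean`/`LWECandidateSelectClose.lean`
(`selectIdx N a`: the least index of maximal empirical `|gap|`; `selectNeg N a`: flip if its gap is negative; `selTest`, `selectWith`). The h₃ machine holds the
measurement of the `k+1` candidates as a FLAT list of answer bits — candidate `i`'s `N` verdicts on self-generated LWE tuples at offset `i·2N`, its `N` verdicts on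
uniform tuples at offset `i·2N + N` — followed by the candidates' verdicts on the actual input at offset `(k+1)·2N`. This file computes the selected, possibly flipped,
verdict from that list with integer arithmetic, proves the map typed polynomial time, and identifies it with `selectIdx`/`selectNeg` (everything PROVED; definitions with
bodies; no named fact):

* `dAbs ans N i = |cnt₁ − cnt₂|`, `isBest`, `bestOf` (`findIdx` of the first best index), `negOf`, **`selOut N k ans`**, `selLayout a v` (the flat layout);
* `cntOf_selLayout_lwe/_unif`, `bit_selLayout`, `isBest_iff`, **`bestOf_selLayout`** (`= selectIdx N a`), **`negOf_selLayout`** (`= selectNeg N a`),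
  **`selOut_selLayout`** (`= v (selectIdx N a) != selectNeg N a`, the verdict `selTest` outputs when candidate `j` answered `v j` on the input);
* `dAbs_codeFP`, `isBest_codeFP`, `bestOf_codeFP`, **`selOut_codeFP`**.

## References

* Z. Brakerski, A. Langlois, C. Peikert, O. Regev, D. Stehlé, *Classical hardness of learning with errors*, STOC 2013; arXiv:1306.0281, Thm. 4.1 (proof: selecting among
  the three reductions) and §5. [BrakerskiEtAl2013]
* O. Regev, *On lattices, learning with errors …*, J. ACM 56 (2009), Lemma 4.1 (proof). [RegevLWE2009]
* S. Arora, B. Barak, *Computational Complexity: A Modern Approach*, CUP 2009, §1.3. [AroraBarak2009]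
-/

noncomputable section

namespace Literature.Computability.Cryptography

namespace BLPRS2013

namespace KProg

open Literature.Computability.Complexity Literature.Computability.Complexity.CodeFP LWE LWE.MP12 LWE.MP12.Prog

/-! ### The program -/

/-- `|cnt₁ − cnt₂|` of candidate `i` (offsets `i·2N` and `i·2N + N`). [cite: BrakerskiEtAl2013, Thm. 4.1 (proof)] -/
def dAbs (ans : List Bool) (N i : ℕ) : ℕ := ((cntOf ans (i * (2 * N)) N : ℤ) - (cntOf ans (i * (2 * N) + N) N : ℤ)).natAbs

/-- `i` has maximal `|cnt₁ − cnt₂|` among `0, …, k`. [folklore] -/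
def isBest (ans : List Bool) (N k i : ℕ) : Bool := (List.range (k + 1)).all fun i' => decide (dAbs ans N i' ≤ dAbs ans N i)

/-- **The selected index**: the first best one. [cite: BrakerskiEtAl2013, Thm. 4.1 (proof)] -/
def bestOf (ans : List Bool) (N k : ℕ) : ℕ := (List.range (k + 1)).findIdx (isBest ans N k)

/-- **The flip flag**: the selected candidate's `cnt₁ < cnt₂`. [cite: RegevLWE2009, Lemma 4.1 (proof)] -/
def negOf (ans : List Bool) (N k : ℕ) : Bool :=
  decide (cntOf ans (bestOf ans N k * (2 * N)) N < cntOf ans (bestOf ans N k * (2 * N) + N) N)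

/-- **The selected verdict**: the selected candidate's verdict on the input (bit `(k+1)·2N + best`), flipped by the flag. [cite: BrakerskiEtAl2013, Thm. 4.1 (proof)] -/
def selOut (N k : ℕ) (ans : List Bool) : Bool := decide (0 < cntOf ans ((k + 1) * (2 * N) + bestOf ans N k) 1) != negOf ans N k

/-- **The flat layout of the measurement** `a` and the input verdicts `v`. [folklore] -/
def selLayout {k N : ℕ} (a : Fin (k + 1) → (Fin N → Bool) × (Fin N → Bool)) (v : Fin (k + 1) → Bool) : List Bool :=
  (List.ofFn fun p : Fin ((k + 1) * (2 * N)) =>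
    let i : Fin (k + 1) := (finProdFinEquiv.symm p).1
    let r : Fin (2 * N) := (finProdFinEquiv.symm p).2
    if h : (r : ℕ) < N then (a i).1 ⟨r, h⟩ else (a i).2 ⟨r - N, by omega⟩) ++ List.ofFn v

/-! ### Typed polynomial time -/

section CodeFP

/-- `dAbs` is typed polynomial time in `((answers, N), i)` (`N` unary, `i` binary). [cite: AroraBarak2009, §1.3] -/
theorem dAbs_codeFP : CodeFP (pairE (pairE (rawE bitE) unE) natE) natE (fun p => dAbs p.1.1 p.1.2 p.2) := by
  have ha : CodeFP (pairE (pairE (rawE bitE) unE) natE) (rawE bitE) (fun p => p.1.1) := (fst _ _).fst'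
  have hN : CodeFP (pairE (pairE (rawE bitE) unE) natE) unE (fun p => p.1.2) := (fst _ _).snd'
  have hi : CodeFP (pairE (pairE (rawE bitE) unE) natE) natE (fun p => p.2) := snd _ _
  have hoffN : CodeFP (pairE (pairE (rawE bitE) unE) natE) natE (fun p => p.2 * (2 * p.1.2)) :=
    (natMul.comp (hi.pair (natMul.comp ((const _ 2).pair (natOfUn.comp hN)))) :)
  have hoff₁ : CodeFP (pairE (pairE (rawE bitE) unE) natE) unE (fun p => min (p.2 * (2 * p.1.2)) p.1.1.length) :=
    (unOfNatMin.comp (((ulength _).comp ha).pair hoffN) :)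
  have hoff₂ : CodeFP (pairE (pairE (rawE bitE) unE) natE) unE (fun p => min (p.2 * (2 * p.1.2) + p.1.2) p.1.1.length) :=
    (unOfNatMin.comp (((ulength _).comp ha).pair (natAdd.comp (hoffN.pair (natOfUn.comp hN)))) :)
  have hc₁ : CodeFP (pairE (pairE (rawE bitE) unE) natE) natE (fun p => cntOf p.1.1 (p.2 * (2 * p.1.2)) p.1.2) :=
    (cntOf_codeFP.comp (ha.pair (hoff₁.pair hN))).congr fun p => cntOf_min _ _ _
  have hc₂ : CodeFP (pairE (pairE (rawE bitE) unE) natE) natE (fun p => cntOf p.1.1 (p.2 * (2 * p.1.2) + p.1.2) p.1.2) :=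
    (cntOf_codeFP.comp (ha.pair (hoff₂.pair hN))).congr fun p => cntOf_min _ _ _
  exact ((intNatAbs.comp (intSub.comp ((intOfNat.comp hc₁).pair (intOfNat.comp hc₂)))) :)
  where
  /-- Capping the offset by the length does not change a window count. [folklore] -/
  cntOf_min (ans : List Bool) (off len : ℕ) : cntOf ans (min off ans.length) len = cntOf ans off len := by
    unfold cntOf
    rcases le_total off ans.length with h | h
    · rw [min_eq_left h]
    · rw [min_eq_right h, List.drop_of_length_le le_rfl, List.drop_of_length_le h]

/-- `isBest` is typed polynomial time in `((answers, (N, k)), i)`. [cite: AroraBarak2009, §1.3] -/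
theorem isBest_codeFP : CodeFP (pairE (pairE (rawE bitE) (pairE unE unE)) natE) bitE (fun p => isBest p.1.1 p.1.2.1 p.1.2.2 p.2) := by
  -- context `((answers, (N, k)), i)`, item `i'`
  have hctx : CodeFP (pairE (pairE (pairE (rawE bitE) (pairE unE unE)) natE) natE) (pairE (rawE bitE) unE) (fun t => (t.1.1.1, t.1.1.2.1)) :=
    (fst _ _).fst'.fst'.pair (fst _ _).fst'.snd'.fst'
  have hd' : CodeFP (pairE (pairE (pairE (rawE bitE) (pairE unE unE)) natE) natE) natE (fun t => dAbs t.1.1.1 t.1.1.2.1 t.2) :=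
    (dAbs_codeFP.comp (hctx.pair (snd _ _)) :)
  have hd : CodeFP (pairE (pairE (pairE (rawE bitE) (pairE unE unE)) natE) natE) natE (fun t => dAbs t.1.1.1 t.1.1.2.1 t.1.2) :=
    (dAbs_codeFP.comp (hctx.pair (fst _ _).snd') :)
  have hpred : CodeFP (pairE (pairE (pairE (rawE bitE) (pairE unE unE)) natE) natE) bitE (fun t => decide (dAbs t.1.1.1 t.1.1.2.1 t.2 ≤ dAbs t.1.1.1 t.1.1.2.1 t.1.2)) :=
    (natLe.comp (hd'.pair hd) :)
  have hrange : CodeFP (pairE (pairE (rawE bitE) (pairE unE unE)) natE) (rawE natE) (fun p => List.range (p.1.2.2 + 1)) :=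
    (urange.comp (unSucc.comp (fst _ _).snd'.snd') :)
  exact (((all hpred).comp ((CodeFP.id _).pair hrange)).congr fun p => rfl)

/-- `bestOf` is typed polynomial time in `(answers, (N, k))`. [cite: AroraBarak2009, §1.3] -/
theorem bestOf_codeFP : CodeFP (pairE (rawE bitE) (pairE unE unE)) natE (fun p => bestOf p.1 p.2.1 p.2.2) := by
  have hrange : CodeFP (pairE (rawE bitE) (pairE unE unE)) (rawE natE) (fun p => List.range (p.2.2 + 1)) := (urange.comp (unSucc.comp (snd _ _).snd') :)
  exact (((findIdxFP isBest_codeFP).comp ((CodeFP.id _).pair hrange)).congr fun p => rfl)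

/-- **The selected verdict is typed polynomial time** in `(answers, (N, k))` (`N, k` unary). [cite: BrakerskiEtAl2013, §5; AroraBarak2009, §1.3] -/
theorem selOut_codeFP : CodeFP (pairE (rawE bitE) (pairE unE unE)) bitE (fun p => selOut p.2.1 p.2.2 p.1) := by
  have ha : CodeFP (pairE (rawE bitE) (pairE unE unE)) (rawE bitE) (fun p => p.1) := fst _ _
  have hN : CodeFP (pairE (rawE bitE) (pairE unE unE)) unE (fun p => p.2.1) := (snd _ _).fst'
  have hk : CodeFP (pairE (rawE bitE) (pairE unE unE)) unE (fun p => p.2.2) := (snd _ _).snd'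
  have hb : CodeFP (pairE (rawE bitE) (pairE unE unE)) natE (fun p => bestOf p.1 p.2.1 p.2.2) := bestOf_codeFP
  have h2N : CodeFP (pairE (rawE bitE) (pairE unE unE)) natE (fun p => 2 * p.2.1) := (natMul.comp ((const _ 2).pair (natOfUn.comp hN)) :)
  have hoffB : CodeFP (pairE (rawE bitE) (pairE unE unE)) natE (fun p => bestOf p.1 p.2.1 p.2.2 * (2 * p.2.1)) := (natMul.comp (hb.pair h2N) :)
  have hcap : ∀ {g : List Bool × (ℕ × ℕ) → ℕ}, CodeFP (pairE (rawE bitE) (pairE unE unE)) natE g →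
      CodeFP (pairE (rawE bitE) (pairE unE unE)) unE (fun p => min (g p) p.1.length) := fun hg =>
    (unOfNatMin.comp (((ulength _).comp ha).pair hg) :)
  have hcnt : ∀ {g : List Bool × (ℕ × ℕ) → ℕ} {l : List Bool × (ℕ × ℕ) → ℕ}, CodeFP (pairE (rawE bitE) (pairE unE unE)) natE g →
      CodeFP (pairE (rawE bitE) (pairE unE unE)) unE l → CodeFP (pairE (rawE bitE) (pairE unE unE)) natE (fun p => cntOf p.1 (g p) (l p)) := fun hg hl =>
    (cntOf_codeFP.comp (ha.pair ((hcap hg).pair hl))).congr fun p => dAbs_codeFP.cntOf_min _ _ _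
  have hneg : CodeFP (pairE (rawE bitE) (pairE unE unE)) bitE (fun p => negOf p.1 p.2.1 p.2.2) := by
    unfold negOf
    exact (natLt.comp ((hcnt hoffB hN).pair (hcnt (natAdd.comp (hoffB.pair (natOfUn.comp hN))) hN)) :)
  have hidx : CodeFP (pairE (rawE bitE) (pairE unE unE)) natE (fun p => (p.2.2 + 1) * (2 * p.2.1) + bestOf p.1 p.2.1 p.2.2) :=
    (natAdd.comp ((natMul.comp ((natOfUn.comp (unSucc.comp hk)).pair h2N)).pair hb) :)
  have hbit : CodeFP (pairE (rawE bitE) (pairE unE unE)) bitE (fun p => decide (0 < cntOf p.1 ((p.2.2 + 1) * (2 * p.2.1) + bestOf p.1 p.2.1 p.2.2) 1)) :=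
    (natLt.comp ((const _ 0).pair (hcnt hidx (const _ 1))) :)
  exact ((xor hbit hneg).congr fun p => rfl)

end CodeFP

/-! ### The bridge to `selectIdx` / `selectNeg` -/

section Bridge

variable {k N : ℕ} (a : Fin (k + 1) → (Fin N → Bool) × (Fin N → Bool)) (v : Fin (k + 1) → Bool)

/-- A window of the flat layout inside the measurement part. [folklore] -/
theorem take_drop_selLayout (off len : ℕ) (h : off + len ≤ (k + 1) * (2 * N)) :
    ((selLayout a v).drop off).take len = List.ofFn fun t : Fin len =>
      (let p : Fin ((k + 1) * (2 * N)) := ⟨off + t, by omega⟩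
       let i : Fin (k + 1) := (finProdFinEquiv.symm p).1
       let r : Fin (2 * N) := (finProdFinEquiv.symm p).2
       if h : (r : ℕ) < N then (a i).1 ⟨r, h⟩ else (a i).2 ⟨r - N, by omega⟩) := by
  unfold selLayout
  rw [List.drop_append_of_le_length (by simp; omega), List.take_append_of_le_length (by simp; omega)]
  exact take_drop_ofFn _ off len h

/-- Decomposing the flat index `i·2N + r`. [folklore] -/
theorem finProdFinEquiv_symm_mk (i : Fin (k + 1)) (r : Fin (2 * N)) (h : (i : ℕ) * (2 * N) + r < (k + 1) * (2 * N)) :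
    finProdFinEquiv.symm (⟨(i : ℕ) * (2 * N) + r, h⟩ : Fin ((k + 1) * (2 * N))) = (i, r) := by
  rw [Equiv.symm_apply_eq]
  exact Fin.ext (by rw [val_finProdFinEquiv])

/-- **Candidate `i`'s LWE-window count is `cnt (a i).1`.** [folklore] -/
theorem cntOf_selLayout_lwe (i : Fin (k + 1)) : ((cntOf (selLayout a v) (i * (2 * N)) N : ℕ) : ℝ) = cnt (a i).1 := by
  have hi : (i : ℕ) * (2 * N) + N ≤ (k + 1) * (2 * N) := by nlinarith [i.2]
  unfold cntOf
  rw [take_drop_selLayout a v _ _ hi, count_ofFn_eq_cnt]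
  congr 1
  funext t
  have hlt : (i : ℕ) * (2 * N) + t < (k + 1) * (2 * N) := by have := t.2; omega
  have key := finProdFinEquiv_symm_mk (k := k) (N := N) i ⟨t, by omega⟩ hlt
  simp only [key, Fin.is_lt, ↓reduceDIte, Fin.eta]

/-- **Candidate `i`'s uniform-window count is `cnt (a i).2`.** [folklore] -/
theorem cntOf_selLayout_unif (i : Fin (k + 1)) : ((cntOf (selLayout a v) (i * (2 * N) + N) N : ℕ) : ℝ) = cnt (a i).2 := by
  have hi : (i : ℕ) * (2 * N) + N + N ≤ (k + 1) * (2 * N) := by nlinarith [i.2]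
  unfold cntOf
  rw [take_drop_selLayout a v _ _ hi, count_ofFn_eq_cnt]
  congr 1
  funext t
  have hlt : (i : ℕ) * (2 * N) + (N + t) < (k + 1) * (2 * N) := by have := t.2; omega
  have key := finProdFinEquiv_symm_mk (k := k) (N := N) i ⟨N + t, by omega⟩ hlt
  have hnot : ¬ (N + (t : ℕ) < N) := by omega
  simp only [show (i : ℕ) * (2 * N) + N + t = (i : ℕ) * (2 * N) + (N + t) by ring, key, hnot, ↓reduceDIte]
  exact congrArg (a i).2 (Fin.ext (by simp))

/-- The input verdict bit of candidate `j` sits at `(k+1)·2N + j`. [folklore] -/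
theorem bit_selLayout (j : Fin (k + 1)) : decide (0 < cntOf (selLayout a v) ((k + 1) * (2 * N) + j) 1) = v j := by
  unfold cntOf selLayout
  rw [List.drop_append, List.drop_of_length_le (by simp), List.nil_append, List.length_ofFn, Nat.add_sub_cancel_left]
  have h := take_drop_ofFn v j 1 (by have := j.2; omega)
  rw [h, List.ofFn_succ, List.ofFn_zero]
  have : (⟨(j : ℕ) + ((0 : Fin 1) : ℕ), by simp [j.2]⟩ : Fin (k + 1)) = j := Fin.ext (by simp only [Fin.val_zero]; omega)
  rw [this]
  cases v j <;> simp

/-- `dAbs` on the layout is `|cnt₁ − cnt₂|` of the candidate. [folklore] -/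
theorem cast_dAbs_selLayout (i : Fin (k + 1)) : ((dAbs (selLayout a v) N i : ℕ) : ℝ) = |cnt (a i).1 - cnt (a i).2| := by
  unfold dAbs
  rw [Nat.cast_natAbs, Int.cast_abs]
  push_cast
  rw [cntOf_selLayout_lwe, cntOf_selLayout_unif]

/-- `|gHat i| = dAbs i / N`. [folklore] -/
theorem abs_gHat_eq (i : Fin (k + 1)) : |gHat N a i| = ((dAbs (selLayout a v) N i : ℕ) : ℝ) / N := by
  rw [cast_dAbs_selLayout, gHat, abs_div, Nat.abs_cast]

/-- **`isBest` on the layout is `IsBestCand`.** [folklore] -/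
theorem isBest_iff (i : Fin (k + 1)) : isBest (selLayout a v) N k i = true ↔ IsBestCand N a i := by
  unfold isBest IsBestCand
  rw [List.all_eq_true]
  simp only [List.mem_range, decide_eq_true_eq]
  constructor
  · intro h i'
    rw [abs_gHat_eq a v, abs_gHat_eq a v]
    exact div_le_div_of_nonneg_right (by exact_mod_cast h i' i'.2) (Nat.cast_nonneg N)
  · intro h i' hi'
    have h' := h ⟨i', hi'⟩
    rw [abs_gHat_eq a v, abs_gHat_eq a v] at h'
    rcases Nat.eq_zero_or_pos N with hN | hN
    · -- `N = 0`: all counts vanish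
      subst hN
      have h0 : ∀ j : Fin (k + 1), dAbs (selLayout a v) 0 j = 0 := by
        intro j
        have := cast_dAbs_selLayout a v j
        simp only [MP12.cnt, Finset.univ_eq_empty, Finset.sum_empty, sub_zero, abs_zero, Nat.cast_eq_zero] at this
        exact this
      rw [show (i' : ℕ) = ((⟨i', hi'⟩ : Fin (k + 1)) : ℕ) from rfl, h0, h0]
    · have hNr : (0 : ℝ) < N := by exact_mod_cast hN
      have := (div_le_div_iff_of_pos_right hNr).1 h'
      exact_mod_cast this

/-- **The program selects `selectIdx`.** [cite: BrakerskiEtAl2013, Thm. 4.1 (proof)] -/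
theorem bestOf_selLayout : bestOf (selLayout a v) N k = (selectIdx N a : ℕ) := by
  classical
  unfold bestOf
  set j := selectIdx N a with hj
  have hlen : (j : ℕ) < (List.range (k + 1)).length := by rw [List.length_range]; exact j.2
  rw [List.findIdx_eq hlen]
  constructor
  · rw [List.getElem_range]
    exact (isBest_iff a v j).2 (isBestCand_selectIdx N a)
  · intro m hm
    rw [List.getElem_range]
    have hmk : m < k + 1 := hm.trans j.2
    rw [Bool.eq_false_iff]
    intro hbest
    have hcand : IsBestCand N a ⟨m, hmk⟩ := (isBest_iff a v ⟨m, hmk⟩).1 hbest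
    have hle : j ≤ ⟨m, hmk⟩ := by
      rw [hj, selectIdx]
      exact Finset.min'_le _ _ (Finset.mem_filter.2 ⟨Finset.mem_univ _, hcand⟩)
    exact absurd (Fin.le_def.1 hle) (by simp; omega)

/-- **The program's flip flag is `selectNeg`.** [cite: RegevLWE2009, Lemma 4.1 (proof)] -/
theorem negOf_selLayout : negOf (selLayout a v) N k = selectNeg N a := by
  unfold negOf selectNeg
  rw [bestOf_selLayout a v]
  have h1 := cntOf_selLayout_lwe a v (selectIdx N a)
  have h2 := cntOf_selLayout_unif a v (selectIdx N a)
  rw [Bool.eq_iff_iff, decide_eq_true_iff, decide_eq_true_iff, gHat]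
  rcases Nat.eq_zero_or_pos N with hN | hN
  · subst hN
    have hc : ∀ f : Fin 0 → Bool, MP12.cnt f = 0 := fun f => by simp [MP12.cnt]
    simp only [hc, sub_self, Nat.cast_zero, div_zero, lt_self_iff_false, iff_false, not_lt]
    unfold cntOf
    simp
  · have hNr : (0 : ℝ) < N := by exact_mod_cast hN
    have hcast : cntOf (selLayout a v) ((selectIdx N a : ℕ) * (2 * N)) N < cntOf (selLayout a v) ((selectIdx N a : ℕ) * (2 * N) + N) N ↔
        MP12.cnt (a (selectIdx N a)).1 < MP12.cnt (a (selectIdx N a)).2 := by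
      rw [← h1, ← h2, Nat.cast_lt]
    rw [hcast, div_neg_iff]
    constructor
    · intro h
      exact Or.inr ⟨by linarith, hNr⟩
    · rintro (⟨-, h⟩ | ⟨h, -⟩)
      · linarith
      · linarith

/-- **The program outputs the selected candidate's input verdict, flipped by `selectNeg`** — the verdict of `selTest E N a` when candidate `i` answered `v i` on the input.
[cite: BrakerskiEtAl2013, Thm. 4.1 (proof)] -/
theorem selOut_selLayout : selOut N k (selLayout a v) = (v (selectIdx N a) != selectNeg N a) := by
  unfold selOut
  rw [negOf_selLayout a v, bestOf_selLayout a v, bit_selLayout a v]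

end Bridge

end KProg

end BLPRS2013

end Literature.Computability.Cryptography

end
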